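import Mathlib.Tactic.Ring
import Mathlib.Tactic.NormNum
import Mathlib.Tactic.Linarith
import Mathlib.Tactic.Positivity
import Mathlib.Data.Real.Basic
import HarnessLib

/-!
# The charge-zero lemma: the three-atom MATRIX inequality and the chord step, kernel-checked

Third file of the charge-zero lemma (prover 2, generation 8 of the hodge-weil ladder cell; note
`b2b-hweil-pv2-g8/CHARGE-ZERO-LEMMA.md`; dictionary in `WeilClassTestChargeZeroLemma.lean`). The first two files check the
counterexample, the identities and the certificate polynomials; this one turns the three-atom certificate into the actual
statement used by the proof (Theorem 1 of the note for `n = 3`), and checks the two pieces of "glue" that the note's reduction uses: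

* `threeAtoms_matrix_psd_of_calP_nonneg` — THEOREM 1 FOR THREE ATOMS: for weights `p_k > 0` and positions `|x_k| ≤ p_k`
  (`k = 1,2,3`), with `T = Σp`, `M = Σx_kp_k`, `V_k = T² + M − 3Tx_k`, `a_k = p_k(2T − x_k)`, the quadratic form
  `Σ_k a_kV_k z_k² + (Σ_k a_k z_k)²` is nonnegative for all real `z` (i.e. `diag(a_kV_k) + aaᵀ ⪰ 0`), GIVEN the certificate
  inequality `0 ≤ 3Σ_k p_kU_kΠ_{l≠k}V_l` — which is exactly the statement `threeAtoms_calP_nonneg` of the companion file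
  `WeilClassTestChargeZeroLemmaThreeAtoms.lean` (kept as a hypothesis here only so that this file does not import that one; the
  two-line combination is left to the reader / a later file). Proof as in the note, §3 (A)(B)(D): at most one `V_k < 0`
  (`at_most_one_exceptional_le`, the non-strict form of the main file's lemma); if none, the form is a sum of nonnegative terms; if
  `V₁ < 0 < V₂, V₃`, the explicit sum-of-squares identity `schur_identity_three` (`K·W·F = a₁K𝒬z₁² + (…)² + W a₂a₃(…)²`,
  `K = a₂V₃ + a₃V₂`, `W = V₂V₃ + K`) reduces `F ≥ 0` to `𝒬 ≥ 0`, and `T·𝒬 = Σ_k p_kU_kΠV` (`calPQ_three`).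
  [cite: HornJohnson2013, §7.7 (Schur complements and positive semidefiniteness)]
* `phi_chord_identity` / `phi_chord` — the CHORD INEQUALITY for `φ(y) = (2T − y)/(Z − 3Ty)` on an interval `[L, U]` below the
  pole, in polynomial (denominator-free) form, with the exact defect `3T(6T² − Z)(U − L)(x − L)(U − x) ≥ 0`: this is step (C) of
  the note (replacing the non-exceptional atoms by two atoms at the extreme positions can only increase `Σ p_kφ(x_k)`).
  [cite: HardyLittlewoodPolya1952, §3.5]

What is NOT here (stays in the dictionary): the bookkeeping that sums the chord inequality over the non-exceptional atoms and
feeds the resulting three-atom configuration into `threeAtoms_matrix_psd_of_calP_nonneg` (note §3 (C)), and Steps 1–3 of §4 (the multiplier and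
the bordered determinant for a general number of roots).
-/

namespace Literature.AlgebraicGeometry.HodgeTheory.WeilClassTestChargeZeroLemma

/-! ### (C) the chord step -/

/-- (C) Exact defect of the chord inequality for `φ(y) = (2T − y)/(Z − 3Ty)`: with `D_y = Z − 3Ty`,
`[(U−x)(2T−L)D_U + (x−L)(2T−U)D_L]·D_x − (U−L)(2T−x)D_LD_U = 3T(6T² − Z)(U−L)(x−L)(U−x)`. [folklore] -/
theorem phi_chord_identity (T Z L U x : ℝ) :
    ((U - x) * (2 * T - L) * (Z - 3 * T * U) + (x - L) * (2 * T - U) * (Z - 3 * T * L)) * (Z - 3 * T * x)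
        - (U - L) * (2 * T - x) * (Z - 3 * T * L) * (Z - 3 * T * U)
      = 3 * T * (6 * T ^ 2 - Z) * (U - L) * (x - L) * (U - x) := by
  ring

/-- (C) The chord inequality (denominator-free form): for `T ≥ 0`, `Z ≤ 6T²` and `L ≤ x ≤ U`,
`(U−L)(2T−x)D_LD_U ≤ [(U−x)(2T−L)D_U + (x−L)(2T−U)D_L]·D_x`; when `D_U = Z − 3TU > 0` (all three points below the pole, so
`D_L ≥ D_x ≥ D_U > 0`) this says `φ(x) ≤ ((U−x)φ(L) + (x−L)φ(U))/(U−L)`, i.e. `φ` lies below its chords (convexity).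
[cite: HardyLittlewoodPolya1952, §3.5] -/
theorem phi_chord (T Z L U x : ℝ) (hT : 0 ≤ T) (hZ : Z ≤ 6 * T ^ 2) (hLx : L ≤ x) (hxU : x ≤ U) :
    (U - L) * (2 * T - x) * (Z - 3 * T * L) * (Z - 3 * T * U)
      ≤ ((U - x) * (2 * T - L) * (Z - 3 * T * U) + (x - L) * (2 * T - U) * (Z - 3 * T * L)) * (Z - 3 * T * x) := by
  have h := phi_chord_identity T Z L U x
  have hdef : 0 ≤ 3 * T * (6 * T ^ 2 - Z) * (U - L) * (x - L) * (U - x) := by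
    have h1 : 0 ≤ 6 * T ^ 2 - Z := by linarith
    have h2 : 0 ≤ U - L := by linarith
    have h3 : 0 ≤ x - L := by linarith
    have h4 : 0 ≤ U - x := by linarith
    positivity
  linarith

/-- (C) Admissibility of the data used in the ladder: with `T ≥ Σ|x_k|`-type weights one always has `Z = T² + M ≤ 2T² ≤ 6T²`
whenever `M ≤ T²` — recorded in the form used to discharge the hypothesis `hZ` of `phi_chord`. [folklore] -/
theorem Z_le_six_T_sq (T M : ℝ) (hM : M ≤ T ^ 2) : T ^ 2 + M ≤ 6 * T ^ 2 := by
  nlinarith [sq_nonneg T]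

/-! ### (A) at most one exceptional atom, non-strict form -/

/-- (A) AT MOST ONE EXCEPTIONAL ATOM, with the second inequality non-strict: if `3Tx₁ > T² + M` and `3Tx₂ ≥ T² + M` for two
atoms of an admissible configuration (`x_i ≤ p_i`, rest weight `P ≥ 0`, rest moment `M' ≥ −P²`), then `P < 0` — contradiction.
Same chain as `at_most_one_exceptional` in the main file. [folklore] -/
theorem at_most_one_exceptional_le (p₁ p₂ P x₁ x₂ M' : ℝ) (hp₁ : 0 < p₁) (hp₂ : 0 < p₂) (hP : 0 ≤ P)
    (hx₁ : x₁ ≤ p₁) (hx₂ : x₂ ≤ p₂) (hM' : -P ^ 2 ≤ M')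
    (h₁ : (p₁ + p₂ + P) ^ 2 + (x₁ * p₁ + x₂ * p₂ + M') < 3 * (p₁ + p₂ + P) * x₁)
    (h₂ : (p₁ + p₂ + P) ^ 2 + (x₁ * p₁ + x₂ * p₂ + M') ≤ 3 * (p₁ + p₂ + P) * x₂) : False := by
  set T := p₁ + p₂ + P with hT
  set Z := T ^ 2 + (x₁ * p₁ + x₂ * p₂ + M') with hZ
  have hTpos : 0 < T := by rw [hT]; linarith
  have ha : Z * (p₁ + p₂) < 3 * T * (x₁ * p₁ + x₂ * p₂) := by
    nlinarith [mul_lt_mul_of_pos_right h₁ hp₁, mul_le_mul_of_nonneg_right h₂ hp₂.le]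
  have hb : 2 * Z < 3 * T * (p₁ + p₂) := by
    nlinarith [mul_le_mul_of_nonneg_left hx₁ hTpos.le, mul_le_mul_of_nonneg_left hx₂ hTpos.le]
  have hM : x₁ * p₁ + x₂ * p₂ = Z - T ^ 2 - M' := by rw [hZ]; ring
  have hc : 3 * T * (T ^ 2 - P ^ 2) < Z * (3 * T - (p₁ + p₂)) := by
    rw [hM] at ha; nlinarith [mul_le_mul_of_nonneg_left hM' hTpos.le]
  have hd : 3 * T * (T ^ 2 - P ^ 2) = 3 * T * (p₁ + p₂) * (T + P) := by rw [hT]; ring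
  have hq : 0 < 3 * T - (p₁ + p₂) := by rw [hT]; linarith
  have he : Z * (3 * T - (p₁ + p₂)) < (3 * T * (p₁ + p₂) / 2) * (3 * T - (p₁ + p₂)) := by nlinarith
  have hf : (3 * T * (p₁ + p₂) / 2) * (3 * T - (p₁ + p₂))
      = 3 * T * (p₁ + p₂) * (T + P) - 3 / 2 * T * (p₁ + p₂) * P := by
    rw [hT]; ring
  have hg : 0 ≤ 3 / 2 * T * (p₁ + p₂) * P := by positivity
  linarith

/-! ### (B) the Schur step for three atoms -/

/-- (B) The explicit sum-of-squares identity behind the Schur-complement step for three atoms: with `K = a₂V₃ + a₃V₂`,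
`W = V₂V₃ + K`, `𝒬 = V₁V₂V₃ + a₁V₂V₃ + a₂V₁V₃ + a₃V₁V₂` and `F(z) = Σa_kV_kz_k² + (Σa_kz_k)²`,
`K·W·F(z) = a₁K𝒬z₁² + (a₁Kz₁ + W(a₂z₂ + a₃z₃))² + W a₂a₃ (V₂z₂ − V₃z₃)²`. [cite: HornJohnson2013, §7.7] -/
theorem schur_identity_three (a₁ a₂ a₃ V₁ V₂ V₃ z₁ z₂ z₃ : ℝ) :
    (a₂ * V₃ + a₃ * V₂) * (V₂ * V₃ + a₂ * V₃ + a₃ * V₂)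
        * (a₁ * V₁ * z₁ ^ 2 + a₂ * V₂ * z₂ ^ 2 + a₃ * V₃ * z₃ ^ 2 + (a₁ * z₁ + a₂ * z₂ + a₃ * z₃) ^ 2)
      = a₁ * (a₂ * V₃ + a₃ * V₂) * (V₁ * V₂ * V₃ + a₁ * V₂ * V₃ + a₂ * V₁ * V₃ + a₃ * V₁ * V₂) * z₁ ^ 2
        + (a₁ * (a₂ * V₃ + a₃ * V₂) * z₁ + (V₂ * V₃ + a₂ * V₃ + a₃ * V₂) * (a₂ * z₂ + a₃ * z₃)) ^ 2
        + (V₂ * V₃ + a₂ * V₃ + a₃ * V₂) * (a₂ * a₃) * (V₂ * z₂ - V₃ * z₃) ^ 2 := by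
  ring

/-- (B) If `a_k > 0`, `V₂, V₃ > 0` and `𝒬 ≥ 0` (the sign of `V₁` being arbitrary), the form `F(z) = Σa_kV_kz_k² + (Σa_kz_k)²` is
nonnegative. [cite: HornJohnson2013, §7.7] -/
theorem form_nonneg_of_calQ_nonneg (a₁ a₂ a₃ V₁ V₂ V₃ : ℝ) (ha₁ : 0 < a₁) (ha₂ : 0 < a₂) (ha₃ : 0 < a₃)
    (hV₂ : 0 < V₂) (hV₃ : 0 < V₃) (hQ : 0 ≤ V₁ * V₂ * V₃ + a₁ * V₂ * V₃ + a₂ * V₁ * V₃ + a₃ * V₁ * V₂)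
    (z₁ z₂ z₃ : ℝ) :
    0 ≤ a₁ * V₁ * z₁ ^ 2 + a₂ * V₂ * z₂ ^ 2 + a₃ * V₃ * z₃ ^ 2 + (a₁ * z₁ + a₂ * z₂ + a₃ * z₃) ^ 2 := by
  have hK : 0 < a₂ * V₃ + a₃ * V₂ := by positivity
  have hW : 0 < V₂ * V₃ + a₂ * V₃ + a₃ * V₂ := by positivity
  have h1 : 0 ≤ a₁ * (a₂ * V₃ + a₃ * V₂) * (V₁ * V₂ * V₃ + a₁ * V₂ * V₃ + a₂ * V₁ * V₃ + a₃ * V₁ * V₂) * z₁ ^ 2 :=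
    mul_nonneg (mul_nonneg (mul_nonneg ha₁.le hK.le) hQ) (sq_nonneg _)
  have h2 : 0 ≤ (a₁ * (a₂ * V₃ + a₃ * V₂) * z₁ + (V₂ * V₃ + a₂ * V₃ + a₃ * V₂) * (a₂ * z₂ + a₃ * z₃)) ^ 2 :=
    sq_nonneg _
  have h3 : 0 ≤ (V₂ * V₃ + a₂ * V₃ + a₃ * V₂) * (a₂ * a₃) * (V₂ * z₂ - V₃ * z₃) ^ 2 := by positivity
  have hprod : 0 ≤ (a₂ * V₃ + a₃ * V₂) * (V₂ * V₃ + a₂ * V₃ + a₃ * V₂)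
      * (a₁ * V₁ * z₁ ^ 2 + a₂ * V₂ * z₂ ^ 2 + a₃ * V₃ * z₃ ^ 2 + (a₁ * z₁ + a₂ * z₂ + a₃ * z₃) ^ 2) := by
    rw [schur_identity_three]; exact add_nonneg (add_nonneg h1 h2) h3
  rw [mul_assoc] at hprod
  have hKW : 0 < (a₂ * V₃ + a₃ * V₂) * (V₂ * V₃ + a₂ * V₃ + a₃ * V₂) := mul_pos hK hW
  rw [← mul_assoc] at hprod
  exact le_of_mul_le_mul_left (by simpa using hprod) hKW

/-- (B) Trivial case: all `V_k ≥ 0` and `a_k ≥ 0`. [folklore] -/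
theorem form_nonneg_of_V_nonneg (a₁ a₂ a₃ V₁ V₂ V₃ : ℝ) (ha₁ : 0 ≤ a₁) (ha₂ : 0 ≤ a₂) (ha₃ : 0 ≤ a₃)
    (hV₁ : 0 ≤ V₁) (hV₂ : 0 ≤ V₂) (hV₃ : 0 ≤ V₃) (z₁ z₂ z₃ : ℝ) :
    0 ≤ a₁ * V₁ * z₁ ^ 2 + a₂ * V₂ * z₂ ^ 2 + a₃ * V₃ * z₃ ^ 2 + (a₁ * z₁ + a₂ * z₂ + a₃ * z₃) ^ 2 := by
  positivity

/-- (B)/(D) `Σ_k p_kU_kΠ_{l≠k}V_l = T·𝒬` for three atoms (`T = p₁+p₂+p₃`, `a_k = p_k(2T − x_k)`,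
`𝒬 = ΠV + Σa_kΠ_{l≠k}V_l`), because `U_k = V_k + T(2T − x_k)` and `Σp_kV_kΠ_{l≠k}V_l = TΠV`. [folklore] -/
theorem calPQ_three (p₁ p₂ p₃ x₁ x₂ x₃ M : ℝ) :
    let T := p₁ + p₂ + p₃
    p₁ * (3 * T ^ 2 + M - 4 * T * x₁) * (T ^ 2 + M - 3 * T * x₂) * (T ^ 2 + M - 3 * T * x₃)
        + p₂ * (3 * T ^ 2 + M - 4 * T * x₂) * (T ^ 2 + M - 3 * T * x₁) * (T ^ 2 + M - 3 * T * x₃)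
        + p₃ * (3 * T ^ 2 + M - 4 * T * x₃) * (T ^ 2 + M - 3 * T * x₁) * (T ^ 2 + M - 3 * T * x₂)
      = T * ((T ^ 2 + M - 3 * T * x₁) * (T ^ 2 + M - 3 * T * x₂) * (T ^ 2 + M - 3 * T * x₃)
          + p₁ * (2 * T - x₁) * (T ^ 2 + M - 3 * T * x₂) * (T ^ 2 + M - 3 * T * x₃)
          + p₂ * (2 * T - x₂) * (T ^ 2 + M - 3 * T * x₁) * (T ^ 2 + M - 3 * T * x₃)
          + p₃ * (2 * T - x₃) * (T ^ 2 + M - 3 * T * x₁) * (T ^ 2 + M - 3 * T * x₂)) := by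
  intro T; ring

/-! ### Theorem 1 of the note for three atoms -/

/-- THEOREM 1 (three atoms), modulo the certificate. For weights `p_k > 0` and positions `|x_k| ≤ p_k`, with `T = Σp`,
`M = Σx_kp_k`, `V_k = T² + M − 3Tx_k`, `a_k = p_k(2T − x_k)` (introduced as variables with their defining equations), and GIVEN
`0 ≤ 3Σ_k p_kU_kΠ_{l≠k}V_l` (= `threeAtoms_calP_nonneg` of the companion file, verbatim), the quadratic form
`Σ a_kV_k z_k² + (Σ a_k z_k)²` is nonnegative: `diag(a_kV_k) + aaᵀ ⪰ 0`. Cases: no negative `V_k` (trivial), or exactly one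
(`at_most_one_exceptional_le`), handled by `form_nonneg_of_calQ_nonneg` with `𝒬 ≥ 0` from the hypothesis via `calPQ_three`.
[cite: HornJohnson2013, §7.7] -/
theorem threeAtoms_matrix_psd_of_calP_nonneg (p₁ p₂ p₃ x₁ x₂ x₃ T M V₁ V₂ V₃ a₁ a₂ a₃ : ℝ)
    (hp₁ : 0 < p₁) (hp₂ : 0 < p₂) (hp₃ : 0 < p₃) (hx₁ : |x₁| ≤ p₁) (hx₂ : |x₂| ≤ p₂) (hx₃ : |x₃| ≤ p₃)
    (hT : T = p₁ + p₂ + p₃) (hM : M = x₁ * p₁ + x₂ * p₂ + x₃ * p₃)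
    (hV₁ : V₁ = T ^ 2 + M - 3 * T * x₁) (hV₂ : V₂ = T ^ 2 + M - 3 * T * x₂) (hV₃ : V₃ = T ^ 2 + M - 3 * T * x₃)
    (ha₁ : a₁ = p₁ * (2 * T - x₁)) (ha₂ : a₂ = p₂ * (2 * T - x₂)) (ha₃ : a₃ = p₃ * (2 * T - x₃))
    (hP : 0 ≤ 3 * (p₁ * (3 * (p₁ + p₂ + p₃) ^ 2 + (x₁ * p₁ + x₂ * p₂ + x₃ * p₃) - 4 * (p₁ + p₂ + p₃) * x₁) * ((p₁ + p₂ + p₃) ^ 2 + (x₁ * p₁ + x₂ * p₂ + x₃ * p₃) - 3 * (p₁ + p₂ + p₃) * x₂) * ((p₁ + p₂ + p₃) ^ 2 + (x₁ * p₁ + x₂ * p₂ + x₃ * p₃) - 3 * (p₁ + p₂ + p₃) * x₃)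
        + p₂ * (3 * (p₁ + p₂ + p₃) ^ 2 + (x₁ * p₁ + x₂ * p₂ + x₃ * p₃) - 4 * (p₁ + p₂ + p₃) * x₂) * ((p₁ + p₂ + p₃) ^ 2 + (x₁ * p₁ + x₂ * p₂ + x₃ * p₃) - 3 * (p₁ + p₂ + p₃) * x₁) * ((p₁ + p₂ + p₃) ^ 2 + (x₁ * p₁ + x₂ * p₂ + x₃ * p₃) - 3 * (p₁ + p₂ + p₃) * x₃)
        + p₃ * (3 * (p₁ + p₂ + p₃) ^ 2 + (x₁ * p₁ + x₂ * p₂ + x₃ * p₃) - 4 * (p₁ + p₂ + p₃) * x₃) * ((p₁ + p₂ + p₃) ^ 2 + (x₁ * p₁ + x₂ * p₂ + x₃ * p₃) - 3 * (p₁ + p₂ + p₃) * x₁) * ((p₁ + p₂ + p₃) ^ 2 + (x₁ * p₁ + x₂ * p₂ + x₃ * p₃) - 3 * (p₁ + p₂ + p₃) * x₂)))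
    (z₁ z₂ z₃ : ℝ) :
    0 ≤ a₁ * V₁ * z₁ ^ 2 + a₂ * V₂ * z₂ ^ 2 + a₃ * V₃ * z₃ ^ 2 + (a₁ * z₁ + a₂ * z₂ + a₃ * z₃) ^ 2 := by
  have hx₁' := abs_le.mp hx₁; have hx₂' := abs_le.mp hx₂; have hx₃' := abs_le.mp hx₃
  have hTpos : 0 < T := by rw [hT]; linarith
  have ha₁p : 0 < a₁ := by rw [ha₁]; apply mul_pos hp₁; rw [hT]; linarith
  have ha₂p : 0 < a₂ := by rw [ha₂]; apply mul_pos hp₂; rw [hT]; linarith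
  have ha₃p : 0 < a₃ := by rw [ha₃]; apply mul_pos hp₃; rw [hT]; linarith
  -- 𝒬 ≥ 0 from the 705-term certificate: T·𝒬 = (Σ p_k U_k Π V)
  have e : T * (V₁ * V₂ * V₃ + a₁ * V₂ * V₃ + a₂ * V₁ * V₃ + a₃ * V₁ * V₂)
      = (p₁ * (3 * (p₁ + p₂ + p₃) ^ 2 + (x₁ * p₁ + x₂ * p₂ + x₃ * p₃) - 4 * (p₁ + p₂ + p₃) * x₁) * ((p₁ + p₂ + p₃) ^ 2 + (x₁ * p₁ + x₂ * p₂ + x₃ * p₃) - 3 * (p₁ + p₂ + p₃) * x₂) * ((p₁ + p₂ + p₃) ^ 2 + (x₁ * p₁ + x₂ * p₂ + x₃ * p₃) - 3 * (p₁ + p₂ + p₃) * x₃)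
        + p₂ * (3 * (p₁ + p₂ + p₃) ^ 2 + (x₁ * p₁ + x₂ * p₂ + x₃ * p₃) - 4 * (p₁ + p₂ + p₃) * x₂) * ((p₁ + p₂ + p₃) ^ 2 + (x₁ * p₁ + x₂ * p₂ + x₃ * p₃) - 3 * (p₁ + p₂ + p₃) * x₁) * ((p₁ + p₂ + p₃) ^ 2 + (x₁ * p₁ + x₂ * p₂ + x₃ * p₃) - 3 * (p₁ + p₂ + p₃) * x₃)
        + p₃ * (3 * (p₁ + p₂ + p₃) ^ 2 + (x₁ * p₁ + x₂ * p₂ + x₃ * p₃) - 4 * (p₁ + p₂ + p₃) * x₃) * ((p₁ + p₂ + p₃) ^ 2 + (x₁ * p₁ + x₂ * p₂ + x₃ * p₃) - 3 * (p₁ + p₂ + p₃) * x₁) * ((p₁ + p₂ + p₃) ^ 2 + (x₁ * p₁ + x₂ * p₂ + x₃ * p₃) - 3 * (p₁ + p₂ + p₃) * x₂)) := by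
    rw [hV₁, hV₂, hV₃, ha₁, ha₂, ha₃, hM, hT]; ring
  have hX := le_of_mul_le_mul_left (by simpa using hP) (by norm_num : (0 : ℝ) < 3)
  have hTQ : 0 ≤ T * (V₁ * V₂ * V₃ + a₁ * V₂ * V₃ + a₂ * V₁ * V₃ + a₃ * V₁ * V₂) := by
    rw [e]; exact hX
  have hQ : 0 ≤ V₁ * V₂ * V₃ + a₁ * V₂ * V₃ + a₂ * V₁ * V₃ + a₃ * V₁ * V₂ :=
    le_of_mul_le_mul_left (by simpa using hTQ) hTpos
  clear hX hTQ e hP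
  -- admissibility facts for the exceptional-atom lemma
  have hm₁ : -p₁ ^ 2 ≤ x₁ * p₁ := by nlinarith [mul_le_mul_of_nonneg_right hx₁'.1 hp₁.le]
  have hm₂ : -p₂ ^ 2 ≤ x₂ * p₂ := by nlinarith [mul_le_mul_of_nonneg_right hx₂'.1 hp₂.le]
  have hm₃ : -p₃ ^ 2 ≤ x₃ * p₃ := by nlinarith [mul_le_mul_of_nonneg_right hx₃'.1 hp₃.le]
  -- the three 'V_k < 0' facts and 'V_k ≤ 0' facts in expanded polynomial form
  by_cases h₁ : V₁ < 0
  · have hV₂p : 0 < V₂ := by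
      by_contra hc; push Not at hc
      refine at_most_one_exceptional_le p₁ p₂ p₃ x₁ x₂ (x₃ * p₃) hp₁ hp₂ hp₃.le hx₁'.2 hx₂'.2 hm₃ ?_ ?_
      · have h' := h₁; rw [hV₁, hM, hT] at h'; ring_nf at h' ⊢; linarith
      · have h' := hc; rw [hV₂, hM, hT] at h'; ring_nf at h' ⊢; linarith
    have hV₃p : 0 < V₃ := by
      by_contra hc; push Not at hc
      refine at_most_one_exceptional_le p₁ p₃ p₂ x₁ x₃ (x₂ * p₂) hp₁ hp₃ hp₂.le hx₁'.2 hx₃'.2 hm₂ ?_ ?_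
      · have h' := h₁; rw [hV₁, hM, hT] at h'; ring_nf at h' ⊢; linarith
      · have h' := hc; rw [hV₃, hM, hT] at h'; ring_nf at h' ⊢; linarith
    exact form_nonneg_of_calQ_nonneg a₁ a₂ a₃ V₁ V₂ V₃ ha₁p ha₂p ha₃p hV₂p hV₃p hQ z₁ z₂ z₃
  by_cases h₂ : V₂ < 0
  · have hV₁p : 0 < V₁ := by
      by_contra hc; push Not at hc
      refine at_most_one_exceptional_le p₂ p₁ p₃ x₂ x₁ (x₃ * p₃) hp₂ hp₁ hp₃.le hx₂'.2 hx₁'.2 hm₃ ?_ ?_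
      · have h' := h₂; rw [hV₂, hM, hT] at h'; ring_nf at h' ⊢; linarith
      · have h' := hc; rw [hV₁, hM, hT] at h'; ring_nf at h' ⊢; linarith
    have hV₃p : 0 < V₃ := by
      by_contra hc; push Not at hc
      refine at_most_one_exceptional_le p₂ p₃ p₁ x₂ x₃ (x₁ * p₁) hp₂ hp₃ hp₁.le hx₂'.2 hx₃'.2 hm₁ ?_ ?_
      · have h' := h₂; rw [hV₂, hM, hT] at h'; ring_nf at h' ⊢; linarith
      · have h' := hc; rw [hV₃, hM, hT] at h'; ring_nf at h' ⊢; linarith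
    have hQ' : 0 ≤ V₂ * V₁ * V₃ + a₂ * V₁ * V₃ + a₁ * V₂ * V₃ + a₃ * V₂ * V₁ := by
      have e' : V₂ * V₁ * V₃ + a₂ * V₁ * V₃ + a₁ * V₂ * V₃ + a₃ * V₂ * V₁
          = V₁ * V₂ * V₃ + a₁ * V₂ * V₃ + a₂ * V₁ * V₃ + a₃ * V₁ * V₂ := by ring
      rw [e']; exact hQ
    have h := form_nonneg_of_calQ_nonneg a₂ a₁ a₃ V₂ V₁ V₃ ha₂p ha₁p ha₃p hV₁p hV₃p hQ' z₂ z₁ z₃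
    have e'' : a₂ * V₂ * z₂ ^ 2 + a₁ * V₁ * z₁ ^ 2 + a₃ * V₃ * z₃ ^ 2 + (a₂ * z₂ + a₁ * z₁ + a₃ * z₃) ^ 2
        = a₁ * V₁ * z₁ ^ 2 + a₂ * V₂ * z₂ ^ 2 + a₃ * V₃ * z₃ ^ 2 + (a₁ * z₁ + a₂ * z₂ + a₃ * z₃) ^ 2 := by ring
    rw [e''] at h; exact h
  by_cases h₃ : V₃ < 0
  · have hV₁p : 0 < V₁ := by
      by_contra hc; push Not at hc
      refine at_most_one_exceptional_le p₃ p₁ p₂ x₃ x₁ (x₂ * p₂) hp₃ hp₁ hp₂.le hx₃'.2 hx₁'.2 hm₂ ?_ ?_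
      · have h' := h₃; rw [hV₃, hM, hT] at h'; ring_nf at h' ⊢; linarith
      · have h' := hc; rw [hV₁, hM, hT] at h'; ring_nf at h' ⊢; linarith
    have hV₂p : 0 < V₂ := by
      by_contra hc; push Not at hc
      refine at_most_one_exceptional_le p₃ p₂ p₁ x₃ x₂ (x₁ * p₁) hp₃ hp₂ hp₁.le hx₃'.2 hx₂'.2 hm₁ ?_ ?_
      · have h' := h₃; rw [hV₃, hM, hT] at h'; ring_nf at h' ⊢; linarith
      · have h' := hc; rw [hV₂, hM, hT] at h'; ring_nf at h' ⊢; linarith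
    have hQ' : 0 ≤ V₃ * V₁ * V₂ + a₃ * V₁ * V₂ + a₁ * V₃ * V₂ + a₂ * V₃ * V₁ := by
      have e' : V₃ * V₁ * V₂ + a₃ * V₁ * V₂ + a₁ * V₃ * V₂ + a₂ * V₃ * V₁
          = V₁ * V₂ * V₃ + a₁ * V₂ * V₃ + a₂ * V₁ * V₃ + a₃ * V₁ * V₂ := by ring
      rw [e']; exact hQ
    have h := form_nonneg_of_calQ_nonneg a₃ a₁ a₂ V₃ V₁ V₂ ha₃p ha₁p ha₂p hV₁p hV₂p hQ' z₃ z₁ z₂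
    have e'' : a₃ * V₃ * z₃ ^ 2 + a₁ * V₁ * z₁ ^ 2 + a₂ * V₂ * z₂ ^ 2 + (a₃ * z₃ + a₁ * z₁ + a₂ * z₂) ^ 2
        = a₁ * V₁ * z₁ ^ 2 + a₂ * V₂ * z₂ ^ 2 + a₃ * V₃ * z₃ ^ 2 + (a₁ * z₁ + a₂ * z₂ + a₃ * z₃) ^ 2 := by ring
    rw [e''] at h; exact h
  push Not at h₁ h₂ h₃
  exact form_nonneg_of_V_nonneg a₁ a₂ a₃ V₁ V₂ V₃ ha₁p.le ha₂p.le ha₃p.le h₁ h₂ h₃ z₁ z₂ z₃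

end Literature.AlgebraicGeometry.HodgeTheory.WeilClassTestChargeZeroLemma
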